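import Literature.NumberTheory.QuadraticFields.RealQuadraticInfrastructureDistance
import Literature.Computability.Cryptography.PseudoPeriodicCorrMass
import HarnessLib

/-!
# Hallgren's periodic function on the principal cycle, discretised: its level sets are combs

Topic `Computability/Cryptography` (next to `HallgrenPell.lean`); the bridge between the
infrastructure of the real quadratic order (`QuadraticFields/RealQuadraticInfrastructureDistance.lean`:
positions `pos m` of the reduced principal ideals along the unrolled cycle, `idx x` = Jozsa's `I_x`)
and the Fourier-sampling analysis of comb tables (`PseudoPeriodicCorrMass.lean`, `IsComb`).
Theorem-and-definition file (no named facts).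

Jozsa 2003, §9: `h(x) = (I_x, x̃ − δ(I_x))` is periodic with period `R` and one-to-one within a
period; §10: `h̃_N(k) = (I_{k/N}, ⌊k/N − δ(I_{k/N})⌋_N)` is one-to-one on a period and *weakly
periodic* with period `S = NR` at every `k` "except possibly at the largest multiple `k/N` of
`1/N` to the left of each reduced ideal" (Prop. 36). We define the table with an additional real
shift `u ∈ [0, 1)` of the sampling grid (used downstream to randomise the fragile points of a
finite-precision evaluation; `u = 0` is Jozsa's `h̃_N`):

* `hTable hD hD4 N u v = (idx ((v+u)/N) mod p, ⌊v + u − N·pos (idx ((v+u)/N))⌋)`;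
* `IsGoodStart`: `v₀` in the first period (`v₀ + u < S`) whose offset `t₀ = v₀ + u − N pos m₀`
  satisfies `⌊t₀⌋ + 1 ≤ N · gap m₀` (not the last grid point before the next ideal);
* **`isComb_hTable`** (Prop. 36 (iii) made exact): the level set through a good start is the comb
  `r_l = ⌈N pos m₀ + lS + ⌊t₀⌋ − u⌉`, `|r_l − (v₀ + lS)| < 1`, with at least `Q/S − 2` teeth in
  `[0, Q)`;
* `hTable_injOn` (Prop. 36 (i)): the table is one-to-one on the starts of the first period;
* `card_badStarts_le` (Prop. 36 (iii), the exceptional set): at most `p` starts of the first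
  period are not good (at most one per ideal).

## References

* R. Jozsa, *Notes on Hallgren's efficient quantum algorithm for solving Pell's equation*,
  arXiv:quant-ph/0302134 (2003), §9 (Thm. 5), §10 (Definition; Prop. 36 (i)–(iii)). [Jozsa2003]
* S. Hallgren, J. ACM 54 (2007), Art. 4, §3–§4. [Hallgren2007]
-/

noncomputable section

open scoped Classical

namespace Literature.Computability.Cryptography

namespace HallgrenTable

open Literature.NumberTheory.QuadraticFields Literature.NumberTheory.QuadraticFields.QuadIrr Finset
  PeriodFinding

variable {D : ℕ} (hD : ¬ IsSquare D) (hD4 : D % 4 = 0 ∨ D % 4 = 1)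

/-- **Hallgren's discretised periodic function** (Jozsa's `h̃_N`, with a grid shift `u`): the label
of the grid point `v` is the ideal to the left of `x = (v + u)/N` (as an index modulo the period)
together with the integer part of the scaled distance gap `N(x − δ(I_x)) = v + u − N pos(idx x)`.
[cite: Jozsa2003, §10 (definition of h̃_N before Prop. 36)] -/
def hTable (N : ℕ) (u : ℝ) (v : ℕ) : ℕ × ℤ :=
  (idx hD hD4 (((v : ℝ) + u) / N) % periodLength D,
    ⌊(v : ℝ) + u - N * pos D (idx hD hD4 (((v : ℝ) + u) / N))⌋)

/-- The scaled period `S = N R`. [cite: Jozsa2003, §10 (S = NR)] -/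
def scaledPeriod (D N : ℕ) : ℝ := N * Real.log (fundUnit D)

/-- **Good starts** of the first period: `v₀ + u < S` and the offset `t₀ = v₀ + u − N pos m₀` of
`v₀` past its ideal `m₀` is not in the last grid cell before the next ideal: `⌊t₀⌋ + 1 ≤ N gap m₀`.
[cite: Jozsa2003, §10 Prop. 36 (iii) (except the largest multiple of 1/N to the left of each ideal)] -/
def IsGoodStart (N : ℕ) (u : ℝ) (v₀ : ℕ) : Prop :=
  (v₀ : ℝ) + u < scaledPeriod D N ∧
    (⌊(v₀ : ℝ) + u - N * pos D (idx hD hD4 (((v₀ : ℝ) + u) / N))⌋ : ℝ) + 1 ≤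
      N * gap D (idx hD hD4 (((v₀ : ℝ) + u) / N))

variable {hD hD4}

/-- The index of a point of the first period is `< p`. [cite: Jozsa2003, §9] -/
theorem idx_lt_periodLength {N : ℕ} (hN : 0 < N) {u : ℝ} (hu : 0 ≤ u) {v₀ : ℕ}
    (h : (v₀ : ℝ) + u < scaledPeriod D N) : idx hD hD4 (((v₀ : ℝ) + u) / N) < periodLength D := by
  have hN' : (0 : ℝ) < N := by exact_mod_cast hN
  have hx : 0 ≤ ((v₀ : ℝ) + u) / N := by positivity
  by_contra hge
  push Not at hge
  have h1 := pos_idx_le hD hD4 hx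
  have h2 : pos D (periodLength D) ≤ pos D (idx hD hD4 (((v₀ : ℝ) + u) / N)) := pos_mono hD hD4 hge
  rw [pos_periodLength hD hD4] at h2
  have : ((v₀ : ℝ) + u) / N < Real.log (fundUnit D) := by
    rw [div_lt_iff₀ hN']; unfold scaledPeriod at h; linarith
  linarith

/-- **The level set through a good start is a comb** (Jozsa's Prop. 36 (iii), exact form): with
`m₀ = idx x₀`, `n₀ = ⌊t₀⌋`, the points `v < Q` with the same label as `v₀` are exactly
`r_l = ⌈N pos m₀ + lS + n₀ − u⌉` for `l = 0, 1, …` as long as `r_l < Q`; they satisfy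
`|r_l − (v₀ + lS)| < 1`, and there are at least `Q/S − 2` of them.
[cite: Jozsa2003, §10 Prop. 36 (iii) (proof)] -/
theorem isComb_hTable {N Q : ℕ} (hN : 0 < N) {u : ℝ} (hu0 : 0 ≤ u) {v₀ : ℕ}
    (hgood : IsGoodStart hD hD4 N u v₀) (hS1 : 1 ≤ scaledPeriod D N) :
    ∃ p : ℕ, (Q : ℝ) / scaledPeriod D N - 2 ≤ p ∧ IsComb Q (scaledPeriod D N) (hTable hD hD4 N u) v₀ p := by
  have hN' : (0 : ℝ) < N := by exact_mod_cast hN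
  obtain ⟨hfirst, hgood2⟩ := hgood
  set S := scaledPeriod D N with hSdef
  set R := Real.log (fundUnit D) with hRdef
  have hSNR : S = N * R := rfl
  have hR : 0 < R := Real.log_pos (one_lt_fundUnit hD hD4)
  have hS0 : 0 < S := by linarith
  set x₀ : ℝ := ((v₀ : ℝ) + u) / N with hx₀
  have hx₀0 : 0 ≤ x₀ := by positivity
  set m₀ := idx hD hD4 x₀ with hm₀
  set t₀ : ℝ := (v₀ : ℝ) + u - N * pos D m₀ with ht₀
  set n₀ : ℤ := ⌊t₀⌋ with hn₀
  have hm₀p : m₀ < periodLength D := idx_lt_periodLength (hD := hD) (hD4 := hD4) hN hu0 hfirst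
  obtain ⟨hpos1, hpos2⟩ := (idx_eq_iff hD hD4 hx₀0 m₀).mp rfl
  rw [hx₀, le_div_iff₀ hN'] at hpos1
  rw [hx₀, div_lt_iff₀ hN', pos_succ] at hpos2
  have ht₀0 : 0 ≤ t₀ := by rw [ht₀]; linarith
  have hn₀0 : 0 ≤ n₀ := Int.floor_nonneg.mpr ht₀0
  have hn₀t : (n₀ : ℝ) ≤ t₀ := Int.floor_le t₀
  have ht₀n : t₀ < n₀ + 1 := Int.lt_floor_add_one t₀
  have hgood2' : (n₀ : ℝ) + 1 ≤ N * gap D m₀ := hgood2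
  have hv₀0 : (0 : ℝ) ≤ v₀ := Nat.cast_nonneg _
  -- the teeth `r_l = ⌈y_l⌉`, `y_l = N pos m₀ + l S + n₀ − u`
  have hylb : ∀ l : ℕ, (v₀ : ℝ) - 1 + l * S < N * pos D m₀ + l * S + n₀ - u := by
    intro l; rw [ht₀] at ht₀n; linarith
  have hyub : ∀ l : ℕ, (N : ℝ) * pos D m₀ + l * S + n₀ - u ≤ v₀ + l * S := by
    intro l; rw [ht₀] at hn₀t; linarith
  have hceil0 : ∀ l : ℕ, 0 ≤ ⌈(N : ℝ) * pos D m₀ + l * S + n₀ - u⌉ := by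
    intro l
    have : (0 : ℝ) ≤ l * S := by positivity
    have h := hylb l
    have : ((-1 : ℤ) : ℝ) < (N : ℝ) * pos D m₀ + l * S + n₀ - u := by push_cast; linarith
    have := Int.lt_ceil.mpr this
    omega
  set r : ℕ → ℕ := fun l => (⌈(N : ℝ) * pos D m₀ + l * S + n₀ - u⌉).toNat with hr
  have hr_eq : ∀ l, ((r l : ℤ) : ℝ) = ⌈(N : ℝ) * pos D m₀ + l * S + n₀ - u⌉ := by
    intro l
    simp only [hr]
    rw [Int.toNat_of_nonneg (hceil0 l)]
  have hr_ge : ∀ l : ℕ, (N : ℝ) * pos D m₀ + l * S + n₀ - u ≤ (r l : ℝ) := fun l => by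
    have := hr_eq l; push_cast at this; rw [this]; exact Int.le_ceil _
  have hr_lt : ∀ l : ℕ, (r l : ℝ) < (N : ℝ) * pos D m₀ + l * S + n₀ - u + 1 := fun l => by
    have := hr_eq l; push_cast at this; rw [this]; exact Int.ceil_lt_add_one _
  have hr_mono : StrictMono r := by
    refine strictMono_nat_of_lt_succ fun l => ?_
    have h1 := hr_lt l
    have h2 := hr_ge (l + 1)
    push_cast at h2
    exact_mod_cast (by linarith : (r l : ℝ) < r (l + 1))
  -- the label of a tooth
  have hlabel : ∀ l : ℕ, idx hD hD4 (((r l : ℝ) + u) / N) = m₀ + l * periodLength D ∧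
      ⌊(r l : ℝ) + u - N * pos D (m₀ + l * periodLength D)⌋ = n₀ := by
    intro l
    have hposl := pos_add_mul_periodLength hD hD4 m₀ l
    have hposl1 : pos D (m₀ + l * periodLength D + 1) = pos D m₀ + gap D m₀ + l * R := by
      rw [Nat.add_right_comm, pos_add_mul_periodLength hD hD4, pos_succ]
    have h1 := hr_ge l
    have h2 := hr_lt l
    rw [hSNR] at h1 h2
    constructor
    · rw [idx_eq_iff hD hD4 (by positivity) _, hposl, hposl1, le_div_iff₀ hN', div_lt_iff₀ hN']
      have hn : (0 : ℝ) ≤ n₀ := by exact_mod_cast hn₀0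
      constructor
      · nlinarith [h1]
      · nlinarith [h2, hgood2']
    · rw [Int.floor_eq_iff, hposl]
      constructor
      · nlinarith [h1]
      · nlinarith [h2]
  have hlabel₀ : hTable hD hD4 N u v₀ = (m₀ % periodLength D, n₀) := rfl
  have htooth : ∀ l, hTable hD hD4 N u (r l) = hTable hD hD4 N u v₀ := by
    intro l
    obtain ⟨h1, h2⟩ := hlabel l
    rw [hlabel₀, hTable, h1, h2, Nat.add_mul_mod_self_right]
  -- the number of teeth in `[0, Q)`
  have hex : ∃ L, Q ≤ r L := by
    obtain ⟨L, hL⟩ := exists_nat_gt (((Q : ℝ) + 1) / S)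
    refine ⟨L, ?_⟩
    have h1 := hr_ge L
    rw [div_lt_iff₀ hS0] at hL
    have h2 := hylb L
    exact_mod_cast (by linarith : (Q : ℝ) < r L).le
  set L := Nat.find hex with hL
  have hLspec : Q ≤ r L := Nat.find_spec hex
  have hLmin : ∀ l < L, r l < Q := fun l hl => not_le.mp (Nat.find_min hex hl)
  refine ⟨L, ?_, r, ?_, hr_mono.injective.injOn, ?_⟩
  · -- `L ≥ Q/S − 2`: the tooth `L` is `≥ Q`, and `r_L < v₀ + LS + 1 ≤ S + LS + 1`
    have h1 := hr_lt L
    have h2 := hyub L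
    have hQL : (Q : ℝ) ≤ r L := by exact_mod_cast hLspec
    have hv : (v₀ : ℝ) < S := by linarith
    rw [sub_le_iff_le_add, div_le_iff₀ hS0]
    linarith
  · intro l _
    have h1 := hr_ge l
    have h2 := hr_lt l
    have h3 := hylb l
    have h4 := hyub l
    rw [abs_lt]
    constructor <;> linarith
  · ext v
    simp only [mem_filter, mem_range, mem_image]
    constructor
    · rintro ⟨hvQ, hv⟩
      -- `v` has the label of `v₀`: recover `l`
      have hx0 : 0 ≤ ((v : ℝ) + u) / N := by positivity
      rw [hlabel₀, hTable] at hv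
      simp only [Prod.mk.injEq] at hv
      obtain ⟨hv1, hv2⟩ := hv
      have hm₀mod : m₀ % periodLength D = m₀ := Nat.mod_eq_of_lt hm₀p
      rw [hm₀mod] at hv1
      set m := idx hD hD4 (((v : ℝ) + u) / N) with hm
      set l := m / periodLength D with hl
      have hml : m = m₀ + l * periodLength D := by
        have := Nat.div_add_mod m (periodLength D)
        rw [hv1] at this
        rw [hl]; linarith [this]
      have hposl := pos_add_mul_periodLength hD hD4 m₀ l
      rw [hml, hposl, Int.floor_eq_iff] at hv2
      obtain ⟨hv2a, hv2b⟩ := hv2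
      -- so `v ∈ [y l, y l + 1)` and `v = r l`
      have hvy1 : (N : ℝ) * pos D m₀ + l * S + n₀ - u ≤ v := by rw [hSNR]; nlinarith [hv2a]
      have hvy2 : (v : ℝ) < (N : ℝ) * pos D m₀ + l * S + n₀ - u + 1 := by rw [hSNR]; nlinarith [hv2b]
      have hvr : v = r l := by
        have h1 := hr_ge l
        have h2 := hr_lt l
        have : |(v : ℝ) - r l| < 1 := by rw [abs_lt]; constructor <;> linarith
        have : |(v : ℤ) - r l| < 1 := by exact_mod_cast this
        have := abs_lt.mp this
        omega
      refine ⟨l, ?_, hvr.symm⟩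
      by_contra hge
      push Not at hge
      have : r L ≤ r l := hr_mono.monotone hge
      omega
    · rintro ⟨l, hl, rfl⟩
      exact ⟨hLmin l hl, htooth l⟩

/-- **The table is one-to-one on the starts of the first period** (Jozsa's Prop. 36 (i)).
[cite: Jozsa2003, §10 Prop. 36 (i)] -/
theorem hTable_injOn {N : ℕ} (hN : 0 < N) {u : ℝ} (hu0 : 0 ≤ u) :
    Set.InjOn (hTable hD hD4 N u) {v₀ : ℕ | (v₀ : ℝ) + u < scaledPeriod D N} := by
  intro v hv w hw hvw
  have hN' : (0 : ℝ) < N := by exact_mod_cast hN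
  simp only [Set.mem_setOf_eq] at hv hw
  have hmv := idx_lt_periodLength (hD := hD) (hD4 := hD4) hN hu0 hv
  have hmw := idx_lt_periodLength (hD := hD) (hD4 := hD4) hN hu0 hw
  rw [hTable, hTable, Prod.mk.injEq, Nat.mod_eq_of_lt hmv, Nat.mod_eq_of_lt hmw] at hvw
  obtain ⟨h1, h2⟩ := hvw
  rw [h1] at h2
  have ha := Int.floor_eq_iff.mp h2
  have hb := Int.floor_eq_iff.mp (rfl : ⌊(w : ℝ) + u - N * pos D (idx hD hD4 (((w : ℝ) + u) / N))⌋ = _)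
  have : |(v : ℝ) - w| < 1 := by rw [abs_lt]; constructor <;> linarith [ha.1, ha.2, hb.1, hb.2]
  have : |(v : ℤ) - w| < 1 := by exact_mod_cast this
  have := abs_lt.mp this
  omega

/-- **At most one bad start per ideal**: the starts of the first period that are not good number
at most `p` (the bad start attached to the ideal `m` is the unique grid point whose offset lies in
`(N gap m − 1, N gap m)`). [cite: Jozsa2003, §10 Prop. 36 (iii) (at most a fraction 1/log d of the values)] -/
theorem card_badStarts_le {N : ℕ} (hN : 0 < N) {u : ℝ} (hu0 : 0 ≤ u) (T : Finset ℕ)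
    (hT : ∀ v₀ ∈ T, (v₀ : ℝ) + u < scaledPeriod D N ∧ ¬ IsGoodStart hD hD4 N u v₀) :
    T.card ≤ periodLength D := by
  have hN' : (0 : ℝ) < N := by exact_mod_cast hN
  -- the map `v₀ ↦ idx x₀` is injective on bad starts and lands in `[0, p)`
  let f : ℕ → ℕ := fun v₀ => idx hD hD4 (((v₀ : ℝ) + u) / N)
  have hmaps : ∀ v₀ ∈ T, f v₀ ∈ range (periodLength D) := fun v₀ hv₀ =>
    mem_range.mpr (idx_lt_periodLength (hD := hD) (hD4 := hD4) hN hu0 (hT v₀ hv₀).1)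
  have hinj : Set.InjOn f T := by
    intro v hv w hw hvw
    have hbv := (hT v hv).2
    have hbw := (hT w hw).2
    unfold IsGoodStart at hbv hbw
    rw [not_and] at hbv hbw
    have hbv := hbv (hT v hv).1
    have hbw := hbw (hT w hw).1
    push Not at hbv hbw
    simp only [f] at hvw
    rw [hvw] at hbv
    set m := idx hD hD4 (((w : ℝ) + u) / N) with hm
    -- both offsets lie in `(N gap m − 1, N gap m)`
    have hxv : 0 ≤ ((v : ℝ) + u) / N := by positivity
    have hxw : 0 ≤ ((w : ℝ) + u) / N := by positivity
    have h1 := (idx_eq_iff hD hD4 hxv m).mp hvw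
    have h2 := (idx_eq_iff hD hD4 hxw m).mp rfl
    rw [pos_succ, le_div_iff₀ hN', div_lt_iff₀ hN'] at h1 h2
    have hfv := Int.floor_le ((v : ℝ) + u - N * pos D m)
    have hfw := Int.floor_le ((w : ℝ) + u - N * pos D m)
    have : |(v : ℝ) - w| < 1 := by
      rw [abs_lt]; constructor <;> linarith
    have : |(v : ℤ) - w| < 1 := by exact_mod_cast this
    have := abs_lt.mp this
    omega
  calc T.card = (T.image f).card := (card_image_of_injOn hinj).symm
    _ ≤ (range (periodLength D)).card := card_le_card (image_subset_iff.mpr hmaps)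
    _ = periodLength D := card_range _

end HallgrenTable

end Literature.Computability.Cryptography

end
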